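import Literature.Analysis.SpecialFunctions.ShiftedGaussLatticeSum
import HarnessLib

/-!
# Two-dimensional Gaussian lattice sums (upper bound, uniform in the centre)

* `sum_gauss_le` — the upper half of `sum_window_gauss_bounds` for an arbitrary finite window:
  `Σ_{k∈I} e^{-s(k-ν)²} ≤ √(π/s)(1 + 2/(e^{π²/s}-1))`;
* `sum_gauss2_le` — for a positive definite form `A x² + 2B xy + C y²` (`C > 0`, `D = AC-B² > 0`)
  and any finite `S ⊆ ℤ²`,
  `Σ_{(i,j)∈S} exp(-(A(i-μ₁)² + 2B(i-μ₁)(j-μ₂) + C(j-μ₂)²)/(2n)) ≤ (2πn/√D)(1+τ(C/2n))(1+τ(D/2nC))`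
  with `τ(s) = 2/(e^{π²/s}-1)` (complete the square in `j`, then in `i`).

Folklore; theorems only.
-/

noncomputable section

open Real Finset

namespace Literature.Analysis.SpecialFunctions

/-- **Gaussian sums over any finite window**: `Σ_{k∈I} e^{-s(k-ν)²} ≤ √(π/s)(1 + 2/(e^{π²/s}-1))`.
[folklore] -/
theorem sum_gauss_le {s : ℝ} (hs : 0 < s) (ν : ℝ) (I : Finset ℤ) :
    ∑ k ∈ I, rexp (-(s * ((k : ℝ) - ν) ^ 2)) ≤
      Real.sqrt (π / s) * (1 + 2 / (rexp (π ^ 2 / s) - 1)) :=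
  (sum_window_gauss_bounds hs ν le_rfl I (fun k hk => absurd hk (by
    have := abs_nonneg ((k : ℝ) - ν); push Not; linarith))).2

/-- The theta-tail factor `1 + 2/(e^{π²/s} - 1)` is at least `1`. [folklore] -/
theorem one_le_thetaFactor {s : ℝ} (hs : 0 < s) : 1 ≤ 1 + 2 / (rexp (π ^ 2 / s) - 1) := by
  have : 0 < rexp (π ^ 2 / s) - 1 := by
    have := Real.one_lt_exp_iff.mpr (by positivity : 0 < π ^ 2 / s)
    linarith
  have : 0 ≤ 2 / (rexp (π ^ 2 / s) - 1) := by positivity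
  linarith

/-- **Two-dimensional Gaussian lattice sums**: for `A, C > 0`, `D = AC - B² > 0`, `n > 0` and any
finite `S ⊆ ℤ²` (so `A > 0` too),
`Σ_{(i,j)∈S} e^{-(A(i-μ₁)² + 2B(i-μ₁)(j-μ₂) + C(j-μ₂)²)/(2n)} ≤ (2πn/√D)·(1+τ(C/2n))·(1+τ(D/2nC))`.
[folklore] -/
theorem sum_gauss2_le {A B C n : ℝ} (hC : 0 < C) (hD : 0 < A * C - B ^ 2)
    (hn : 0 < n) (μ₁ μ₂ : ℝ) (S : Finset (ℤ × ℤ)) :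
    ∑ p ∈ S, rexp (-((A * ((p.1 : ℝ) - μ₁) ^ 2 + 2 * B * ((p.1 : ℝ) - μ₁) * ((p.2 : ℝ) - μ₂) +
        C * ((p.2 : ℝ) - μ₂) ^ 2) / (2 * n))) ≤
      2 * π * n / Real.sqrt (A * C - B ^ 2) *
        ((1 + 2 / (rexp (π ^ 2 / (C / (2 * n))) - 1)) *
          (1 + 2 / (rexp (π ^ 2 / ((A * C - B ^ 2) / (2 * n * C))) - 1))) := by
  classical
  set D := A * C - B ^ 2 with hDdef
  set s₂ : ℝ := C / (2 * n) with hs₂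
  set s₁ : ℝ := D / (2 * n * C) with hs₁
  have hs₂p : 0 < s₂ := by positivity
  have hs₁p : 0 < s₁ := by positivity
  set f : ℤ × ℤ → ℝ := fun p => rexp (-((A * ((p.1 : ℝ) - μ₁) ^ 2 +
      2 * B * ((p.1 : ℝ) - μ₁) * ((p.2 : ℝ) - μ₂) + C * ((p.2 : ℝ) - μ₂) ^ 2) / (2 * n))) with hf
  have hf0 : ∀ p, 0 ≤ f p := fun p => (Real.exp_pos _).le
  -- enlarge to a product window
  set I := S.image Prod.fst with hI
  set J := S.image Prod.snd with hJ
  have hsub : S ⊆ I ×ˢ J := by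
    intro p hp
    rw [mem_product]
    exact ⟨mem_image_of_mem _ hp, mem_image_of_mem _ hp⟩
  have h1 : ∑ p ∈ S, f p ≤ ∑ p ∈ I ×ˢ J, f p :=
    sum_le_sum_of_subset_of_nonneg hsub (fun p _ _ => hf0 p)
  refine le_trans h1 ?_
  rw [sum_product]
  -- complete the square in `j`
  have hsq : ∀ (x y : ℝ), -((A * x ^ 2 + 2 * B * x * y + C * y ^ 2) / (2 * n)) =
      -(s₁ * x ^ 2) + -(s₂ * (y - (-(B / C) * x)) ^ 2) := by
    intro x y
    rw [hs₁, hs₂, hDdef]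
    field_simp
    ring
  have hinner : ∀ i ∈ I, ∑ j ∈ J, f (i, j) ≤
      rexp (-(s₁ * ((i : ℝ) - μ₁) ^ 2)) * (Real.sqrt (π / s₂) * (1 + 2 / (rexp (π ^ 2 / s₂) - 1))) := by
    intro i _
    have : ∀ j ∈ J, f (i, j) = rexp (-(s₁ * ((i : ℝ) - μ₁) ^ 2)) *
        rexp (-(s₂ * ((j : ℝ) - (μ₂ + -(B / C) * ((i : ℝ) - μ₁))) ^ 2)) := by
      intro j _
      rw [hf]
      dsimp only
      rw [hsq, Real.exp_add]
      congr 2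
      ring
    rw [sum_congr rfl this, ← mul_sum]
    exact mul_le_mul_of_nonneg_left (sum_gauss_le hs₂p _ J) (Real.exp_pos _).le
  calc ∑ i ∈ I, ∑ j ∈ J, f (i, j)
      ≤ ∑ i ∈ I, rexp (-(s₁ * ((i : ℝ) - μ₁) ^ 2)) *
          (Real.sqrt (π / s₂) * (1 + 2 / (rexp (π ^ 2 / s₂) - 1))) := sum_le_sum hinner
    _ = (∑ i ∈ I, rexp (-(s₁ * ((i : ℝ) - μ₁) ^ 2))) *
          (Real.sqrt (π / s₂) * (1 + 2 / (rexp (π ^ 2 / s₂) - 1))) := by rw [sum_mul]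
    _ ≤ (Real.sqrt (π / s₁) * (1 + 2 / (rexp (π ^ 2 / s₁) - 1))) *
          (Real.sqrt (π / s₂) * (1 + 2 / (rexp (π ^ 2 / s₂) - 1))) :=
        mul_le_mul_of_nonneg_right (sum_gauss_le hs₁p _ I) (by
          have := one_le_thetaFactor hs₂p; positivity)
    _ = 2 * π * n / Real.sqrt D *
          ((1 + 2 / (rexp (π ^ 2 / s₂) - 1)) * (1 + 2 / (rexp (π ^ 2 / s₁) - 1))) := by
        have hsq1 : Real.sqrt (π / s₁) * Real.sqrt (π / s₂) = 2 * π * n / Real.sqrt D := by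
          rw [← Real.sqrt_mul (by positivity), hs₁, hs₂]
          rw [show π / (D / (2 * n * C)) * (π / (C / (2 * n))) = (2 * π * n) ^ 2 / D by
            field_simp]
          rw [Real.sqrt_div (by positivity), Real.sqrt_sq (by positivity)]
        calc Real.sqrt (π / s₁) * (1 + 2 / (rexp (π ^ 2 / s₁) - 1)) *
              (Real.sqrt (π / s₂) * (1 + 2 / (rexp (π ^ 2 / s₂) - 1)))
            = (Real.sqrt (π / s₁) * Real.sqrt (π / s₂)) *
                ((1 + 2 / (rexp (π ^ 2 / s₂) - 1)) * (1 + 2 / (rexp (π ^ 2 / s₁) - 1))) := by ring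
          _ = _ := by rw [hsq1]

end Literature.Analysis.SpecialFunctions
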